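import Mathlib
import HarnessLib.Audit
import Summits.PneNP.PneNP.Theorems.PstarLocalUnionOutside

/-!
# O2 = the LOCAL union lemma + the ESSENTIAL residue: `TerminalFiveElim` holds, `TerminalFiveEssential → TerminalFiveA` (ROUND-25, memo §14.32; planner p3 g23)

FRONTIER range-avoidance ladder, rung F-N3, ROUND 25 (cell `pnp-ideate`, planner memo `r24/CORE-BOUND-NOTES.md` §14.31–§14.32, typed nodes `TerminalFiveElim`,
`Eliminable`, `TerminalFiveEssential` and the packaging VERBATIM from planner p3 g23's `r25/SketchCross2.lean` (22:21Z, section `pinnedPartners`); restricted-model proof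
complexity — nothing here bears on `P` versus `NP`).

* `TerminalFiveElim` (p3's node) and **`terminalFiveElim_holds`** — the ELIMINABLE class of O2 is a theorem: `w₂` hun-clean; every privates-touching monomial of `w₁`
  contains a variable from a list `us` of variables outside `J₀` unread by `w₂`, or lies in a set `M` of monomials with a slot pinned on `Z`.  (Here derived from
  `PstarLocalUnionOutside.card_le_five_of_pinned_outside` — pin at the Terminal level, then fibre the local data over `us`; p3's sketch proves the same class by
  substitution `restrict1`/`restrictL` and local-level pinning, an equivalent closure calculus.)
* `Eliminable`, `terminal_swap`, `TerminalFiveEssential` (p3, verbatim) — the ESSENTIAL residue: terminal data eliminable in NEITHER orientation;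
* **`terminalFiveA_of_essential : TerminalFiveEssential → TerminalFiveA`** — with `PstarLocalUnionFive.localUnionFive_holds` in the tree, O2 (`TerminalFiveA`) is
  reduced to the single named node `TerminalFiveEssential` (memo §14.32 (C): a free cross gate (`PstarCross2.TerminalFiveCross1Free`), a private × cotree-AND monomial
  with both slots unpinned, an outside partner READ by the other member (DIAG/SHEET of `MultiUnionFive`), or both members privates-dirty);
  `terminalFiveEssential_of_terminalFiveA` — the converse.
-/

set_option linter.dupNamespace false -- `Summit.PneNP.PneNP.…`: summit = sub-problem name (D-0017 single-conjunct layout)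

open Finset Literature.Computability.Complexity
open Summit.PneNP.PneNP.Theorems.PstarTyped (Typed)
open Summit.PneNP.PneNP.Theorems.PstarSALevel (varSet bdry BoundaryExpanding SimpleOverlap)
open Summit.PneNP.PneNP.Theorems.PstarCoreBound (XorClosed)
open Summit.PneNP.PneNP.Theorems.PstarChordRepair (IsChord)
open Summit.PneNP.PneNP.Theorems.PstarChordBridgeCotree (Peelable)
open Summit.PneNP.PneNP.Theorems.PstarChordBridgeTools (privs)
open Summit.PneNP.PneNP.Theorems.PstarCoreBoundTargets (Terminal TerminalFiveA)
open Summit.PneNP.PneNP.Theorems.PstarMultiUnion (Outside)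
open Summit.PneNP.PneNP.Theorems.PstarCross2 (PinnedTo)
open Summit.PneNP.PneNP.Theorems.PstarLocalUnionOutside (card_le_five_of_pinned_outside)

namespace Summit.PneNP.PneNP.Theorems.PstarElim

variable {n m : ℕ}

/-! ## The eliminable class -/

/-- **TARGET: the ELIMINABLE class of O2** (planner p3 g23, `r25/SketchCross2.lean`, verbatim) — `w₂` hun-clean; every privates-touching monomial of `w₁` either
contains a variable from a list `us` of variables outside `J₀` not read by `w₂`, or belongs to a set `M` of monomials (avoiding `us`) each with a slot pinned on `Z`.
PROVED below (`terminalFiveElim_holds`).  FRONTIER. -/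
@[conjecture] def TerminalFiveElim : Prop :=
  ∀ (n m r : ℕ) (I : LocalMap 4 n m), I.IsPure xorAndPred → Typed I → SimpleOverlap I → BoundaryExpanding r I →
  ∀ (y : Fin m → Bool) (J₀ : Finset (Fin m)) (w₁ w₂ : Finset (Fin n) × Finset (Fin m) × Bool), Terminal I r y J₀ w₁ w₂ →
    ∀ F ⊆ J₀, Peelable I F → (∀ F', F ⊆ F' → F' ⊆ J₀ → Peelable I F' → F' = F) → (∀ e ∈ J₀ \ F, IsChord I J₀ e) →
    ∀ (us : List (Fin n)), (∀ u ∈ us, Outside I J₀ u ∧ u ∉ w₂.1 ∧ ∀ g ∈ w₂.2.1, I.vars g 2 ≠ u ∧ I.vars g 3 ≠ u) →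
    ∀ M ⊆ w₁.2.1, (∀ g ∈ M, I.vars g 2 ∉ us ∧ I.vars g 3 ∉ us) →
    ∀ (sl : Fin m → Fin 4) (c : Fin m → Bool), (∀ g ∈ M, sl g = 2 ∨ sl g = 3) →
    (∀ g ∈ M, PinnedTo I y J₀ w₂ (I.vars g (sl g)) (c g)) →
    (∀ g ∈ w₁.2.1, g ∉ M → I.vars g 2 ∉ us → I.vars g 3 ∉ us → ∀ v ∈ privs I (J₀ \ F), I.vars g 2 ≠ v ∧ I.vars g 3 ≠ v) →
    (∀ g ∈ w₂.2.1, ∀ v ∈ privs I (J₀ \ F), I.vars g 2 ≠ v ∧ I.vars g 3 ≠ v) →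
    J₀.card ≤ 5

/-- **`TerminalFiveElim` holds** (pin the monomials of `M`, then fibre over the variables of `us`: `PstarLocalUnionOutside.card_le_five_of_pinned_outside`; the
hypothesis that `M` avoids `us` is not needed). -/
theorem terminalFiveElim_holds : TerminalFiveElim := by
  intro n m r I hI hT hS hB y J₀ w₁ w₂ ht F hF hP hmax hch us hus M hM _ sl c hsl hpin hun₁ hun₂
  classical
  refine card_le_five_of_pinned_outside I hI hT hS hB ht hF hP hmax hch hM hsl hpin (Zs := us.toFinset)
    (fun z hz => (hus z (List.mem_toFinset.1 hz)).1) (fun z hz => (hus z (List.mem_toFinset.1 hz)).2) ?_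
  intro g hg v hv
  rcases mem_union.1 hg with h | h
  · obtain ⟨hgM, h2, h3⟩ := mem_filter.1 h
    obtain ⟨hgw, hgM'⟩ := mem_sdiff.1 hgM
    exact hun₁ g hgw hgM' (fun h' => h2 (List.mem_toFinset.2 h')) (fun h' => h3 (List.mem_toFinset.2 h')) v hv
  · exact hun₂ g h v hv

/-- `TerminalFiveElim` is a sub-target of O2. -/
theorem terminalFiveElim_of_terminalFiveA (h : TerminalFiveA) : TerminalFiveElim :=
  fun n m r I hI hT hS hB y J₀ w₁ w₂ ht F hF hP hmax hch _ _ _ _ _ _ _ _ _ _ _ => h n m r I hI hT hS hB y J₀ w₁ w₂ ht F hF hP hmax hch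

/-! ## Packaging: O2 = the local union lemma + the ESSENTIAL residue -/

/-- `w₁` is ELIMINABLE w.r.t. `w₂` (and `w₂` is hun-clean): the data `(us, M, sl, c)` of `TerminalFiveElim` exist. (p3, verbatim) -/
def Eliminable (I : LocalMap 4 n m) (y : Fin m → Bool) (J₀ F : Finset (Fin m)) (w₁ w₂ : Finset (Fin n) × Finset (Fin m) × Bool) : Prop :=
  ∃ (us : List (Fin n)) (M : Finset (Fin m)) (sl : Fin m → Fin 4) (c : Fin m → Bool),
    (∀ u ∈ us, Outside I J₀ u ∧ u ∉ w₂.1 ∧ ∀ g ∈ w₂.2.1, I.vars g 2 ≠ u ∧ I.vars g 3 ≠ u) ∧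
    M ⊆ w₁.2.1 ∧ (∀ g ∈ M, I.vars g 2 ∉ us ∧ I.vars g 3 ∉ us) ∧ (∀ g ∈ M, sl g = 2 ∨ sl g = 3) ∧
    (∀ g ∈ M, PinnedTo I y J₀ w₂ (I.vars g (sl g)) (c g)) ∧
    (∀ g ∈ w₁.2.1, g ∉ M → I.vars g 2 ∉ us → I.vars g 3 ∉ us → ∀ v ∈ privs I (J₀ \ F), I.vars g 2 ≠ v ∧ I.vars g 3 ≠ v) ∧
    (∀ g ∈ w₂.2.1, ∀ v ∈ privs I (J₀ \ F), I.vars g 2 ≠ v ∧ I.vars g 3 ≠ v)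

/-- Terminal data are symmetric in the two constraints. (p3, verbatim) -/
theorem terminal_swap (I : LocalMap 4 n m) {r : ℕ} {y : Fin m → Bool} {J₀ : Finset (Fin m)} {w₁ w₂ : Finset (Fin n) × Finset (Fin m) × Bool}
    (ht : Terminal I r y J₀ w₁ w₂) : Terminal I r y J₀ w₂ w₁ := by
  obtain ⟨hne, hX, hcard, hd₁, hd₂, hrad, hT3, hM0⟩ := ht
  refine ⟨hne, hX, hcard, hd₂, hd₁, ?_, fun ⟨x, hsol, hA, hw⟩ => hT3 ⟨x, hsol, hw, hA⟩, fun f hf => ?_⟩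
  · rwa [union_assoc, union_comm w₂.2.1, ← union_assoc]
  · obtain ⟨x, hsol, hA, hw⟩ := hM0 f hf
    exact ⟨x, hsol, hw, hA⟩

/-- **TARGET (OPEN): the ESSENTIAL residue of O2** (p3, verbatim) — terminal data in which NEITHER orientation is eliminable (memo §14.32 (C): for both orientations
the `Z`-defining member is privates-dirty or the other member has an essential monomial — a free cross gate, a cotree-AND partner, or an outside partner read by the
other member).  FRONTIER. -/
@[conjecture] def TerminalFiveEssential : Prop :=
  ∀ (n m r : ℕ) (I : LocalMap 4 n m), I.IsPure xorAndPred → Typed I → SimpleOverlap I → BoundaryExpanding r I →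
  ∀ (y : Fin m → Bool) (J₀ : Finset (Fin m)) (w₁ w₂ : Finset (Fin n) × Finset (Fin m) × Bool), Terminal I r y J₀ w₁ w₂ →
    ∀ F ⊆ J₀, Peelable I F → (∀ F', F ⊆ F' → F' ⊆ J₀ → Peelable I F' → F' = F) → (∀ e ∈ J₀ \ F, IsChord I J₀ e) →
    ¬ Eliminable I y J₀ F w₁ w₂ → ¬ Eliminable I y J₀ F w₂ w₁ → J₀.card ≤ 5

/-- **O2 IS REDUCED TO THE ESSENTIAL RESIDUE: `TerminalFiveEssential → TerminalFiveA`** (p3's packaging `terminalFiveA_of_localUnionFive_of_essential` with the local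
union lemma discharged by `terminalFiveElim_holds`). -/
theorem terminalFiveA_of_essential (hE : TerminalFiveEssential) : TerminalFiveA := by
  intro n m r I hI hT hS hB y J₀ w₁ w₂ ht F hF hP hmax hch
  by_cases h₁ : Eliminable I y J₀ F w₁ w₂
  · obtain ⟨us, M, sl, c, hus, hM, hMus, hsl, hpin, hun₁, hun₂⟩ := h₁
    exact terminalFiveElim_holds n m r I hI hT hS hB y J₀ w₁ w₂ ht F hF hP hmax hch us hus M hM hMus sl c hsl hpin hun₁ hun₂
  by_cases h₂ : Eliminable I y J₀ F w₂ w₁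
  · obtain ⟨us, M, sl, c, hus, hM, hMus, hsl, hpin, hun₁, hun₂⟩ := h₂
    exact terminalFiveElim_holds n m r I hI hT hS hB y J₀ w₂ w₁ (terminal_swap I ht) F hF hP hmax hch us hus M hM hMus sl c hsl hpin hun₁ hun₂
  exact hE n m r I hI hT hS hB y J₀ w₁ w₂ ht F hF hP hmax hch h₁ h₂

/-- The essential residue is a sub-target of O2. (p3, verbatim) -/
theorem terminalFiveEssential_of_terminalFiveA (h : TerminalFiveA) : TerminalFiveEssential :=
  fun n m r I hI hT hS hB y J₀ w₁ w₂ ht F hF hP hmax hch _ _ => h n m r I hI hT hS hB y J₀ w₁ w₂ ht F hF hP hmax hch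

end Summit.PneNP.PneNP.Theorems.PstarElim
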